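import Mathlib.GroupTheory.Index
import Mathlib.GroupTheory.OrderOfElement
import Mathlib.Data.ZMod.QuotientGroup
import Mathlib.Algebra.Module.Torsion.Basic
import Mathlib.Tactic.IntervalCases
import HarnessLib

/-!
# Crux `PrintCf2.SplitBadTwoRankOneOfFacts` (item stmt-BirchSwinnertonDyer-20368), road α over the CM field:
# complementary summands of a `p`-divisible `p`-primary group with `#M[p] = p²` — each is `p`-divisible with
# `#Cᵢ[p^k] = p^k` CYCLIC, and every summand-preserving additive map is an integer scalar on `Cᵢ[p^k]` (generic §1)

Cell `bsd-print-cf2`, width seat `bsd-line-cf2-p1-w2` g7; `--supports stmt-BirchSwinnertonDyer-20368` (helper); generic algebra behind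
the structure of the CM summands `E[𝔭^∞]`, `E[𝔭̄^∞]` of `E_L[2^∞]` (companion file `…CMPrimaryStructure`, which applies this to the
decomposition `CMPrimes.exists_cmPrimaryDecomposition_two` of p644268). HONEST FRAMING: nothing here closes a crux or a stub; BSD is not
proved by any of this; no summit statement is proved by this seat. No definition is introduced.

For complementary subgroups `C₁ ⊓ C₂ = ⊥`, `C₁ ⊔ C₂ = ⊤` of a `p`-primary, `p`-DIVISIBLE abelian group `M` with `#M[p] = p²`, both
non-trivial (exactly the situation `E[p^∞] = E[𝔭^∞] ⊕ E[𝔭̄^∞]` of a CM curve at a split prime; Rubin, LNM 1716, §2, Prop. 5.4: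
`E[𝔭^k] ≅ 𝓞/𝔭^k`): `eq_of_add_eq_add_of_inf_eq_bot` (uniqueness of the decomposition), `exists_nsmul_eq_of_mem` (each summand is
`p`-divisible), `nsmul_eq_zero_of_add` (torsion splits), `exists_ne_zero_nsmul_eq_zero`, `card_inf_torsionBy_prime` (`#Cᵢ[p] = p`:
`M[p] = C₁[p] ⊕ C₂[p]`, both factors `> 1`, product `p²`), `card_inf_torsionBy_prime_pow` (`#C₁[p^k] = p^k` along
`0 → C₁[p] → C₁[p^{k+1}] → C₁[p^k] → 0`), `exists_generator_inf_torsionBy` (`C₁[p^k] = ℤ·g`, `ord g = p^k`),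
`exists_int_smul_eq_on_inf_torsionBy` (every `C₁`-preserving additive map — e.g. a Galois automorphism — is an integer scalar on
`C₁[p^k]`: the summand carries a character, level by level).

References: K. Rubin, LNM 1716 (1999), §2, Prop. 5.4; [SilvermanAEC2009] III.§7 (structure of `E[m]`); elementary abelian-group
theory (`End(ℤ/p^k) = ℤ/p^k`).
-/

noncomputable section

open scoped Classical

set_option linter.dupNamespace false
set_option autoImplicit false

namespace Summit.BirchSwinnertonDyer.BirchSwinnertonDyer.Theorems.PrintCf2.CMPrimes

/-! ## §1 Generic: complementary summands of a `p`-divisible `p`-primary group with `#M[p] = p²` -/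

section Structure

variable {p : ℕ} [hp : Fact p.Prime] {M : Type*} [AddCommGroup M] {C₁ C₂ : AddSubgroup M}

omit hp in
/-- **Uniqueness of the decomposition along complementary subgroups**: if `C₁ ⊓ C₂ = ⊥` and
`x₁ + x₂ = y₁ + y₂` with `xᵢ, yᵢ ∈ Cᵢ`, then `x₁ = y₁` and `x₂ = y₂`. [folklore] -/
theorem eq_of_add_eq_add_of_inf_eq_bot (hinf : C₁ ⊓ C₂ = ⊥) {x₁ x₂ y₁ y₂ : M} (hx₁ : x₁ ∈ C₁)
    (hx₂ : x₂ ∈ C₂) (hy₁ : y₁ ∈ C₁) (hy₂ : y₂ ∈ C₂) (h : x₁ + x₂ = y₁ + y₂) :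
    x₁ = y₁ ∧ x₂ = y₂ := by
  have hd : x₁ - y₁ = y₂ - x₂ := by
    rw [sub_eq_iff_eq_add, sub_add_eq_add_sub, eq_sub_iff_add_eq, h, add_comm]
  have hmem : x₁ - y₁ ∈ C₁ ⊓ C₂ :=
    AddSubgroup.mem_inf.mpr ⟨C₁.sub_mem hx₁ hy₁, hd ▸ C₂.sub_mem hy₂ hx₂⟩
  rw [hinf, AddSubgroup.mem_bot] at hmem
  refine ⟨sub_eq_zero.mp hmem, ?_⟩
  rw [hmem, eq_comm, sub_eq_zero] at hd
  exact hd.symm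

omit hp in
/-- **Each complementary summand of a `p`-divisible group is `p`-divisible**: if `M = C₁ ⊕ C₂` and `p·M = M`, then
for `x ∈ C₁` there is `y ∈ C₁` with `p·y = x` (project a `p`-th root of `x`). [folklore] -/
theorem exists_nsmul_eq_of_mem (hinf : C₁ ⊓ C₂ = ⊥) (hsup : C₁ ⊔ C₂ = ⊤)
    (hdiv : ∀ x : M, ∃ y : M, p • y = x) {x : M} (hx : x ∈ C₁) :
    ∃ y ∈ C₁, p • y = x := by
  obtain ⟨y, hy⟩ := hdiv x
  have hy' : y ∈ C₁ ⊔ C₂ := hsup ▸ AddSubgroup.mem_top y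
  obtain ⟨y₁, hy₁, y₂, hy₂, rfl⟩ := AddSubgroup.mem_sup.mp hy'
  refine ⟨y₁, hy₁, ?_⟩
  rw [smul_add] at hy
  -- `p y₁ + p y₂ = x + 0`
  have h := eq_of_add_eq_add_of_inf_eq_bot hinf (C₁.nsmul_mem hy₁ p) (C₂.nsmul_mem hy₂ p) hx C₂.zero_mem
    (by rw [add_zero]; exact hy)
  exact h.1

omit hp in
/-- **Torsion splits along the decomposition**: if `x = x₁ + x₂` (`xᵢ ∈ Cᵢ`, `C₁ ⊓ C₂ = ⊥`) and `n·x = 0`, then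
`n·x₁ = 0` and `n·x₂ = 0`. [folklore] -/
theorem nsmul_eq_zero_of_add (hinf : C₁ ⊓ C₂ = ⊥) {x₁ x₂ : M} (hx₁ : x₁ ∈ C₁) (hx₂ : x₂ ∈ C₂) {n : ℕ}
    (h : n • (x₁ + x₂) = 0) : n • x₁ = 0 ∧ n • x₂ = 0 := by
  rw [smul_add] at h
  exact eq_of_add_eq_add_of_inf_eq_bot hinf (C₁.nsmul_mem hx₁ n) (C₂.nsmul_mem hx₂ n) C₁.zero_mem
    C₂.zero_mem (by rw [add_zero]; exact h)

omit hp in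
/-- A non-trivial subgroup of a `p`-primary group contains a non-zero element killed by `p`. [folklore] -/
theorem exists_ne_zero_nsmul_eq_zero (hM : ∀ x : M, ∃ k : ℕ, p ^ k • x = 0) (hC : C₁ ≠ ⊥) :
    ∃ y ∈ C₁, y ≠ 0 ∧ p • y = 0 := by
  obtain ⟨x, hx, hx0⟩ : ∃ x ∈ C₁, x ≠ 0 := by
    by_contra h
    push Not at h
    exact hC ((AddSubgroup.eq_bot_iff_forall _).mpr h)
  have hex : ∃ k : ℕ, p ^ k • x = 0 := hM x
  -- the least `k` with `p^k x = 0` is positive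
  set k₀ := Nat.find hex with hk₀
  have hk₀spec : p ^ k₀ • x = 0 := Nat.find_spec hex
  have hk₀pos : k₀ ≠ 0 := by
    intro h0
    rw [h0, pow_zero, one_smul] at hk₀spec
    exact hx0 hk₀spec
  obtain ⟨j, hj⟩ := Nat.exists_eq_succ_of_ne_zero hk₀pos
  refine ⟨p ^ j • x, C₁.nsmul_mem hx _, ?_, ?_⟩
  · have := Nat.find_min hex (m := j) (by rw [← hk₀, hj]; exact Nat.lt_succ_self j)
    exact this
  · rw [← mul_smul, ← pow_succ', ← Nat.succ_eq_add_one, ← hj]; exact hk₀spec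

/-- **`#C₁[p] = p = #C₂[p]`**: with `M = C₁ ⊕ C₂` `p`-primary, both summands non-trivial, and `#M[p] = p²`, each
`Cᵢ[p] = Cᵢ ⊓ M[p]` has exactly `p` elements (`M[p] = C₁[p] ⊕ C₂[p]`, both factors `> 1`, product `p²`). [folklore] -/
theorem card_inf_torsionBy_prime (hM : ∀ x : M, ∃ k : ℕ, p ^ k • x = 0) (hinf : C₁ ⊓ C₂ = ⊥) (hsup : C₁ ⊔ C₂ = ⊤)
    (h₁ : C₁ ≠ ⊥) (h₂ : C₂ ≠ ⊥)
    (hcard : Nat.card (AddSubgroup.torsionBy M (p : ℕ)) = p ^ 2) :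
    Nat.card ↥(C₁ ⊓ AddSubgroup.torsionBy M (p : ℕ)) = p ∧
      Nat.card ↥(C₂ ⊓ AddSubgroup.torsionBy M (p : ℕ)) = p := by
  set T := AddSubgroup.torsionBy M (p : ℕ) with hT
  have hmemT : ∀ {x : M}, x ∈ T ↔ p • x = 0 := fun {x} ↦ AddSubgroup.torsionBy.nsmul_iff
  -- the bijection `(C₁ ⊓ T) × (C₂ ⊓ T) ≃ T`, `(a, b) ↦ a + b`
  have hbij : Function.Bijective
      (fun ab : ↥(C₁ ⊓ T) × ↥(C₂ ⊓ T) ↦ (⟨(ab.1 : M) + ab.2,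
        T.add_mem (AddSubgroup.mem_inf.mp ab.1.2).2 (AddSubgroup.mem_inf.mp ab.2.2).2⟩ : ↥T)) := by
    constructor
    · rintro ⟨⟨a, ha⟩, ⟨b, hb⟩⟩ ⟨⟨a', ha'⟩, ⟨b', hb'⟩⟩ h
      have h' : a + b = a' + b' := congrArg Subtype.val h
      obtain ⟨rfl, rfl⟩ := eq_of_add_eq_add_of_inf_eq_bot hinf (AddSubgroup.mem_inf.mp ha).1
        (AddSubgroup.mem_inf.mp hb).1 (AddSubgroup.mem_inf.mp ha').1 (AddSubgroup.mem_inf.mp hb').1 h'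
      rfl
    · rintro ⟨x, hx⟩
      have hx' : x ∈ C₁ ⊔ C₂ := hsup ▸ AddSubgroup.mem_top x
      obtain ⟨x₁, hx₁, x₂, hx₂, rfl⟩ := AddSubgroup.mem_sup.mp hx'
      obtain ⟨h1, h2⟩ := nsmul_eq_zero_of_add hinf hx₁ hx₂ (hmemT.mp hx)
      exact ⟨⟨⟨x₁, AddSubgroup.mem_inf.mpr ⟨hx₁, hmemT.mpr h1⟩⟩, ⟨x₂, AddSubgroup.mem_inf.mpr ⟨hx₂, hmemT.mpr h2⟩⟩⟩,
          rfl⟩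
  have hprod : Nat.card ↥(C₁ ⊓ T) * Nat.card ↥(C₂ ⊓ T) = p ^ 2 := by
    rw [← hcard, ← Nat.card_prod]
    exact Nat.card_congr (Equiv.ofBijective _ hbij)
  -- both factors exceed `1`
  haveI : Finite ↥T := Nat.finite_of_card_ne_zero (by rw [hcard]; exact pow_ne_zero _ hp.out.ne_zero)
  have hgt : ∀ {C : AddSubgroup M}, C ≠ ⊥ → 1 < Nat.card ↥(C ⊓ T) := fun {C} hC ↦ by
    obtain ⟨y, hy, hy0, hpy⟩ := exists_ne_zero_nsmul_eq_zero (C₁ := C) hM hC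
    haveI : Finite ↥(C ⊓ T) := Finite.of_injective (fun z : ↥(C ⊓ T) ↦ (⟨z.1, (AddSubgroup.mem_inf.mp z.2).2⟩ : ↥T))
      (fun a b h ↦ Subtype.ext (by simpa using congrArg Subtype.val h))
    rw [Finite.one_lt_card_iff_nontrivial]
    exact ⟨⟨⟨y, AddSubgroup.mem_inf.mpr ⟨hy, hmemT.mpr hpy⟩⟩, ⟨0, (C ⊓ T).zero_mem⟩,
      fun h ↦ hy0 (congrArg Subtype.val h)⟩⟩
  have ha := hgt h₁
  have hb := hgt h₂
  -- `a * b = p²`, `a, b > 1` ⇒ `a = b = p`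
  set a := Nat.card ↥(C₁ ⊓ T)
  set b := Nat.card ↥(C₂ ⊓ T)
  have hadvd : a ∣ p ^ 2 := Dvd.intro b hprod
  obtain ⟨i, hi, hai⟩ := (Nat.dvd_prime_pow hp.out).mp hadvd
  interval_cases i
  · rw [pow_zero] at hai; omega
  · refine ⟨by rw [hai, pow_one], ?_⟩
    rw [hai, pow_one, pow_two] at hprod
    exact Nat.eq_of_mul_eq_mul_left hp.out.pos hprod
  · exfalso
    rw [hai] at hprod
    have : b = 1 := by
      have hp2 : 0 < p ^ 2 := pow_pos hp.out.pos 2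
      nlinarith
    omega

/-- **`#C₁[p^k] = p^k`** for a complementary summand `C₁` of a `p`-divisible `p`-primary `M = C₁ ⊕ C₂` with `#M[p] = p²` and both
summands non-trivial: induction on `k` along `0 → C₁[p] → C₁[p^{k+1}] → C₁[p^k] → 0` (multiplication by `p`, onto by divisibility).
(`C₁ ≅ ℚ_p/ℤ_p`: the `p`-primary CM summand `E[𝔭^∞]` has `ℤ_p`-corank one.) [folklore] -/
theorem card_inf_torsionBy_prime_pow (hM : ∀ x : M, ∃ k : ℕ, p ^ k • x = 0) (hinf : C₁ ⊓ C₂ = ⊥)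
    (hsup : C₁ ⊔ C₂ = ⊤) (hdiv : ∀ x : M, ∃ y : M, p • y = x) (h₁ : C₁ ≠ ⊥) (h₂ : C₂ ≠ ⊥)
    (hcard : Nat.card (AddSubgroup.torsionBy M (p : ℕ)) = p ^ 2) (k : ℕ) :
    Nat.card ↥(C₁ ⊓ AddSubgroup.torsionBy M (p ^ k : ℕ)) = p ^ k := by
  have hmemT : ∀ {n : ℕ} {x : M}, x ∈ AddSubgroup.torsionBy M (n : ℕ) ↔ n • x = 0 :=
    fun {n} {x} ↦ AddSubgroup.torsionBy.nsmul_iff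
  induction k with
  | zero =>
    rw [pow_zero, Nat.card_eq_one_iff_unique]
    refine ⟨⟨fun a b ↦ Subtype.ext ?_⟩, ⟨0, (C₁ ⊓ _).zero_mem⟩⟩
    have ha := hmemT.mp (AddSubgroup.mem_inf.mp a.2).2
    have hb := hmemT.mp (AddSubgroup.mem_inf.mp b.2).2
    simp only [one_smul] at ha hb
    rw [ha, hb]
  | succ k ih =>
    set A := C₁ ⊓ AddSubgroup.torsionBy M (p ^ (k + 1) : ℕ) with hA
    set B := C₁ ⊓ AddSubgroup.torsionBy M (p ^ k : ℕ) with hB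
    -- multiplication by `p`: `A → B`
    have hmapmem : ∀ x : ↥A, p • (x : M) ∈ B := fun x ↦ by
      obtain ⟨hxC, hxT⟩ := AddSubgroup.mem_inf.mp x.2
      refine AddSubgroup.mem_inf.mpr ⟨C₁.nsmul_mem hxC p, hmemT.mpr ?_⟩
      rw [← mul_smul, ← pow_succ]; exact hmemT.mp hxT
    let f : ↥A →+ ↥B :=
      { toFun := fun x ↦ ⟨p • (x : M), hmapmem x⟩
        map_zero' := Subtype.ext (by simp)
        map_add' := fun x y ↦ Subtype.ext (by simp [smul_add]) }
    have hf : ∀ x : ↥A, ((f x : ↥B) : M) = p • (x : M) := fun _ ↦ rfl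
    -- onto, by divisibility inside `C₁`
    have hsurj : Function.Surjective f := by
      rintro ⟨z, hz⟩
      obtain ⟨hzC, hzT⟩ := AddSubgroup.mem_inf.mp hz
      obtain ⟨y, hyC, hy⟩ := exists_nsmul_eq_of_mem hinf hsup hdiv hzC
      have hyA : y ∈ A := AddSubgroup.mem_inf.mpr ⟨hyC, hmemT.mpr (by
        rw [pow_succ, mul_smul, hy]; exact hmemT.mp hzT)⟩
      exact ⟨⟨y, hyA⟩, Subtype.ext (by rw [hf]; exact hy)⟩
    -- kernel `≃ C₁[p]`
    have hker : Nat.card f.ker = p := by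
      rw [← (card_inf_torsionBy_prime hM hinf hsup h₁ h₂ hcard).1]
      refine Nat.card_congr
        { toFun := fun x ↦ ⟨((x : ↥A) : M), AddSubgroup.mem_inf.mpr
            ⟨(AddSubgroup.mem_inf.mp x.1.2).1, hmemT.mpr (by
              have := congrArg (fun z : ↥B ↦ (z : M)) ((AddMonoidHom.mem_ker).mp x.2)
              simpa [hf] using this)⟩⟩
          invFun := fun y ↦ ⟨⟨(y : M), AddSubgroup.mem_inf.mpr ⟨(AddSubgroup.mem_inf.mp y.2).1, hmemT.mpr (by
              rw [pow_succ, mul_smul, hmemT.mp (AddSubgroup.mem_inf.mp y.2).2, smul_zero])⟩⟩,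
            (AddMonoidHom.mem_ker).mpr (Subtype.ext (by
              rw [hf]; exact hmemT.mp (AddSubgroup.mem_inf.mp y.2).2))⟩
          left_inv := fun x ↦ Subtype.ext (Subtype.ext rfl)
          right_inv := fun y ↦ Subtype.ext rfl }
    have hrange : f.range = ⊤ := AddMonoidHom.range_eq_top.mpr hsurj
    have h1 := AddSubgroup.card_mul_index f.ker
    rw [AddSubgroup.index_ker, hrange, AddSubgroup.card_top, hker, ih] at h1
    rw [← h1, pow_succ, mul_comm]

/-- **`C₁[p^k]` is cyclic of order `p^k`**: there is `g ∈ C₁` of order exactly `p^k` with `C₁[p^k] = ℤ·g`. [folklore] -/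
theorem exists_generator_inf_torsionBy (hM : ∀ x : M, ∃ k : ℕ, p ^ k • x = 0) (hinf : C₁ ⊓ C₂ = ⊥)
    (hsup : C₁ ⊔ C₂ = ⊤) (hdiv : ∀ x : M, ∃ y : M, p • y = x) (h₁ : C₁ ≠ ⊥) (h₂ : C₂ ≠ ⊥)
    (hcard : Nat.card (AddSubgroup.torsionBy M (p : ℕ)) = p ^ 2) (k : ℕ) :
    ∃ g ∈ C₁, addOrderOf g = p ^ k ∧ C₁ ⊓ AddSubgroup.torsionBy M (p ^ k : ℕ) = AddSubgroup.zmultiples g := by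
  have hmemT : ∀ {n : ℕ} {x : M}, x ∈ AddSubgroup.torsionBy M (n : ℕ) ↔ n • x = 0 :=
    fun {n} {x} ↦ AddSubgroup.torsionBy.nsmul_iff
  -- an element of order exactly `p^k` in `C₁`
  have hgen : ∃ g ∈ C₁, addOrderOf g = p ^ k := by
    induction k with
    | zero => exact ⟨0, C₁.zero_mem, by rw [pow_zero, addOrderOf_zero]⟩
    | succ k ih =>
      obtain ⟨g, hgC, hg⟩ := ih
      rcases Nat.eq_zero_or_pos k with rfl | hk
      · obtain ⟨y, hyC, hy0, hpy⟩ := exists_ne_zero_nsmul_eq_zero hM h₁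
        exact ⟨y, hyC, by rw [zero_add, pow_one]; exact addOrderOf_eq_prime hpy hy0⟩
      · obtain ⟨y, hyC, hy⟩ := exists_nsmul_eq_of_mem hinf hsup hdiv hgC
        refine ⟨y, hyC, addOrderOf_eq_prime_pow ?_ ?_⟩
        · -- `p^k y = p^{k-1} g ≠ 0`
          obtain ⟨j, rfl⟩ := Nat.exists_eq_succ_of_ne_zero hk.ne'
          rw [pow_succ, mul_smul, hy]
          refine nsmul_ne_zero_of_lt_addOrderOf (pow_ne_zero _ hp.out.ne_zero) ?_
          rw [hg]; exact Nat.pow_lt_pow_right hp.out.one_lt (Nat.lt_succ_self j)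
        · rw [pow_succ, mul_smul, hy, ← hg]; exact addOrderOf_nsmul_eq_zero g
  obtain ⟨g, hgC, hg⟩ := hgen
  refine ⟨g, hgC, hg, ?_⟩
  -- `ℤ·g ≤ C₁[p^k]`, both of order `p^k`
  have hle : AddSubgroup.zmultiples g ≤ C₁ ⊓ AddSubgroup.torsionBy M (p ^ k : ℕ) := by
    rw [AddSubgroup.zmultiples_le]
    exact AddSubgroup.mem_inf.mpr ⟨hgC, hmemT.mpr (by rw [← hg]; exact addOrderOf_nsmul_eq_zero g)⟩
  have hK : Nat.card ↥(C₁ ⊓ AddSubgroup.torsionBy M (p ^ k : ℕ)) = p ^ k :=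
    card_inf_torsionBy_prime_pow hM hinf hsup hdiv h₁ h₂ hcard k
  haveI : Finite ↥(C₁ ⊓ AddSubgroup.torsionBy M (p ^ k : ℕ)) :=
    Nat.finite_of_card_ne_zero (by rw [hK]; exact pow_ne_zero _ hp.out.ne_zero)
  exact (AddSubgroup.eq_of_le_of_card_ge hle (by rw [hK, Nat.card_zmultiples, hg])).symm

/-- **Every additive map preserving `C₁` acts on `C₁[p^k]` by an INTEGER SCALAR** (`End(ℤ/p^k) = ℤ/p^k`): for `g' : M →+ M` with
`g'(C₁) ⊆ C₁` — e.g. a Galois automorphism, when `C₁` is Galois-stable — and every `k` there is `N ∈ ℤ` with `g' x = N x` for all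
`x ∈ C₁` killed by `p^k`. (The CM summand `E[𝔭^∞] ≅ ℚ_p/ℤ_p` carries a CHARACTER `Γ_K → ℤ_p^×`, here level by level.) [folklore] -/
theorem exists_int_smul_eq_on_inf_torsionBy (hM : ∀ x : M, ∃ k : ℕ, p ^ k • x = 0) (hinf : C₁ ⊓ C₂ = ⊥)
    (hsup : C₁ ⊔ C₂ = ⊤) (hdiv : ∀ x : M, ∃ y : M, p • y = x) (h₁ : C₁ ≠ ⊥) (h₂ : C₂ ≠ ⊥)
    (hcard : Nat.card (AddSubgroup.torsionBy M (p : ℕ)) = p ^ 2) (g' : M →+ M) (hg' : ∀ x ∈ C₁, g' x ∈ C₁)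
    (k : ℕ) : ∃ N : ℤ, ∀ x ∈ C₁, p ^ k • x = 0 → g' x = N • x := by
  have hmemT : ∀ {n : ℕ} {x : M}, x ∈ AddSubgroup.torsionBy M (n : ℕ) ↔ n • x = 0 :=
    fun {n} {x} ↦ AddSubgroup.torsionBy.nsmul_iff
  obtain ⟨g, hgC, hg, hgen⟩ := exists_generator_inf_torsionBy hM hinf hsup hdiv h₁ h₂ hcard k
  have hpk : p ^ k • g = 0 := by rw [← hg]; exact addOrderOf_nsmul_eq_zero g
  -- `g' g ∈ C₁[p^k] = ℤ·g`
  have hg'g : g' g ∈ AddSubgroup.zmultiples g := by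
    rw [← hgen]
    exact AddSubgroup.mem_inf.mpr ⟨hg' g hgC, hmemT.mpr (by rw [← map_nsmul, hpk, map_zero])⟩
  obtain ⟨N, hN⟩ := AddSubgroup.mem_zmultiples_iff.mp hg'g
  refine ⟨N, fun x hxC hxk ↦ ?_⟩
  have hx : x ∈ AddSubgroup.zmultiples g := by
    rw [← hgen]; exact AddSubgroup.mem_inf.mpr ⟨hxC, hmemT.mpr hxk⟩
  obtain ⟨a, rfl⟩ := AddSubgroup.mem_zmultiples_iff.mp hx
  rw [map_zsmul, ← hN, smul_comm]

end Structure

end Summit.BirchSwinnertonDyer.BirchSwinnertonDyer.Theorems.PrintCf2.CMPrimes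

end
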